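import Summits.NavierStokesRegularity.NavierStokesRegularity.Theses.AdaptedFrequency
import Literature.Analysis.FluidPDE.AdaptedBackwardKernel

/-!
# Line `tauberian-omega-limit` — skeleton for crux `AdaptedFrequencyConverges`
(stmt-NavierStokesRegularity-10493; lead prover-line-stmt-NavierStokesRegularity-10493-0)

Rebuilt from the registered stub signatures of planner-cruxplan-…-tauberian-omega-limit (ledger
archive ids 76736–76740; the planner's `Lines/tauberian-omega-limit.lean` never reached the tree).

Composition (sorry-free): with `s = −log (T − t)` and `f = log ((T−t)² H)`, `df/ds = Λ − 2`.
* `stub_kernelCalculus` — `H = adaptedEnstrophy u G` is differentiable near `T` (transport-free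
  first variation `H′ = 2∫(ω·Sω − ν|∇ω|²) G`);
* `stub_pinching` — two-sided pinching `c₀ ≤ (T−t)² H ≤ C₁` near `T` (so `f` is bounded: Λ₀ = 2
  is forced and Cesàro convergence of `Λ − 2` is free);
* `stub_slowDecrease` [hardest] — `Λ` is slowly decreasing at `T` over FIXED log-time windows
  (triage N2): `Λ t ≤ Λ t' + ε` whenever `t ≤ t' < T`, `T − t ≤ 2 (T − t')`, `t` close to `T`;
* `stub_landau` — pure real analysis: bounded `f`, differentiable `H`, slowly decreasing
  `(T−t)H′/H` ⇒ `(T−t)H′/H → 2`.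
Then `AdaptedFrequencyConverges_of : AdaptedFrequencyConverges` with `Λ₀ := 2`.
-/

noncomputable section

namespace Summit.NavierStokesRegularity.NavierStokesRegularity.Cruxes.AdaptedFrequencyConverges.Lines.TauberianOmegaLimit

open scoped InnerProductSpace RealInnerProductSpace Topology
open Literature.Analysis.FluidPDE Set Filter MeasureTheory
open Summit.NavierStokesRegularity.NavierStokesRegularity.Theses.AdaptedFrequency

/-- physical space -/
abbrev E3 := EuclideanSpace ℝ (Fin 3)

/-- The crux hypotheses, bundled: `(u,p)` classical NS on `[0,T)`, Leray–Hopf from a rapidly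
decaying datum, Type-I rate at `T`, `(T,x₀)` backward-singular, `G` a flow-adapted backward kernel
on `[t₀,T)` ending at `δ_{x₀}`, two-sided Gaussian-comparable. -/
structure Setting (ν T : ℝ) (u : ℝ → E3 → E3) (p : ℝ → E3 → ℝ) (x₀ : E3) (t₀ : ℝ)
    (G : ℝ → E3 → ℝ) : Prop where
  hν : 0 < ν
  hT : 0 < T
  classical : IsClassicalNSSolutionOn (Ico 0 T) ν 0 u p
  lerayHopf : IsLerayHopfOn T ν 0 (u 0) u
  decay : HasRapidSpatialDecay (u 0)
  typeI : IsTypeIBlowup u T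
  ht₀ : t₀ ∈ Ico 0 T
  singular : ∀ r : ℝ, 0 < r →
    eLpNorm (Function.uncurry u) ⊤ (volume.restrict (parabolicCylinder r (T, x₀))) = ⊤
  kernel : IsAdaptedBackwardKernel ν u (Ico t₀ T) T x₀ G
  comparable : IsGaussianComparable G (Ico t₀ T) T x₀

/-- **Slow decrease at `T⁻` over fixed log-time windows**: for every `ε > 0`, eventually (for
`t₁ ≤ t ≤ t' < T`) the function drops by at most `ε` across any window with `T − t ≤ 2 (T − t')`,
i.e. of length `≤ log 2` in `s = −log (T − t)`. Implied by convergence at `T⁻`; strictly weaker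
than Schmidt's relative-window slow decrease and than `lim inf dΛ/ds ≥ 0`. -/
def SlowlyDecreasingAt (f : ℝ → ℝ) (T : ℝ) : Prop :=
  ∀ ε > 0, ∃ t₁ < T, ∀ t t' : ℝ, t₁ ≤ t → t ≤ t' → t' < T → T - t ≤ 2 * (T - t') → f t ≤ f t' + ε

/-! ## Stubs -/

/-- **Kernel calculus** (transport-free first variation): near `T` the adapted enstrophy is
differentiable with `H′(t) = 2∫ ⟨ω, (∇u) ω⟩ G − 2ν ∫ |∇ω|² G`, `ω = curl u(t)`. -/
theorem stub_kernelCalculus :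
    ∀ (ν T : ℝ) (u : ℝ → E3 → E3) (p : ℝ → E3 → ℝ) (x₀ : E3) (t₀ : ℝ) (G : ℝ → E3 → ℝ),
      Setting ν T u p x₀ t₀ G → ∃ t₁ ∈ Ico t₀ T, ∀ t ∈ Ioo t₁ T,
        HasDerivAt (adaptedEnstrophy u G)
          (2 * (∫ x, ⟪curl (u t) x, fderiv ℝ (u t) x (curl (u t) x)⟫ * G t x) -
            2 * ν * (∫ x, frobeniusNormSq (fderiv ℝ (curl (u t)) x) * G t x)) t := by
  sorry

/-- **Two-sided pinching** of the rescaled adapted enstrophy near `T`: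
`c₀ ≤ (T−t)² H(t) ≤ C₁` (upper: Type-I derivative bound; lower: ε-regularity + persistence of
singularities + Gaussian lower comparability — the far-field step). -/
theorem stub_pinching :
    ∀ (ν T : ℝ) (u : ℝ → E3 → E3) (p : ℝ → E3 → ℝ) (x₀ : E3) (t₀ : ℝ) (G : ℝ → E3 → ℝ),
      Setting ν T u p x₀ t₀ G → ∃ t₁ ∈ Ico t₀ T, ∃ c₀ C₁ : ℝ, 0 < c₀ ∧ ∀ t ∈ Ico t₁ T,
        c₀ ≤ (T - t) ^ 2 * adaptedEnstrophy u G t ∧ (T - t) ^ 2 * adaptedEnstrophy u G t ≤ C₁ := by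
  sorry

/-- **Slow decrease of the adapted frequency** [hardest stub; the NS content]: `Λ` drops by at
most `ε` over dyadic windows near `T`. -/
theorem stub_slowDecrease :
    ∀ (ν T : ℝ) (u : ℝ → E3 → E3) (p : ℝ → E3 → ℝ) (x₀ : E3) (t₀ : ℝ) (G : ℝ → E3 → ℝ),
      Setting ν T u p x₀ t₀ G → SlowlyDecreasingAt (adaptedFrequency u G T) T := by
  sorry

/-- **Landau-type Tauberian step** (pure real analysis): if `H` is differentiable on `[t₁, T)`,
`(T−t)² H` is pinched between positive constants and `(T−t) H′/H` is slowly decreasing at `T`,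
then `(T−t) H′/H → 2` as `t ↑ T`. -/
theorem stub_landau :
    ∀ (T t₁ : ℝ) (H : ℝ → ℝ), t₁ < T → (∀ t ∈ Ico t₁ T, DifferentiableAt ℝ H t) →
      (∃ c₀ C₁ : ℝ, 0 < c₀ ∧ ∀ t ∈ Ico t₁ T, c₀ ≤ (T - t) ^ 2 * H t ∧ (T - t) ^ 2 * H t ≤ C₁) →
      SlowlyDecreasingAt (fun t => (T - t) * deriv H t / H t) T →
      Tendsto (fun t => (T - t) * deriv H t / H t) (𝓝[<] T) (𝓝 2) := by
  sorry

/-! ## Composition -/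

/-- The line closes the crux: `Λ → 2`. -/
theorem AdaptedFrequencyConverges_of : AdaptedFrequencyConverges := by
  intro ν T hν hT u p hcl hLH hdec hTI x₀ t₀ G ht₀ hsing hK hcomp H Λ hH hΛ
  have hker : IsAdaptedBackwardKernel ν u (Ico t₀ T) T x₀ G := isAdaptedBackwardKernel_iff.2 hK
  have hcmp : IsGaussianComparable G (Ico t₀ T) T x₀ := isGaussianComparable_iff_fin_three.2 hcomp
  have hS : Setting ν T u p x₀ t₀ G :=
    ⟨hν, hT, hcl, hLH, hdec, hTI, ht₀, hsing, hker, hcmp⟩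
  -- `H` is the adapted enstrophy, `Λ` the adapted frequency
  have hH' : H = adaptedEnstrophy u G := by
    rw [hH]; funext t; rfl
  have hΛ' : Λ = adaptedFrequency u G T := by
    rw [hΛ, hH']; funext t; rfl
  refine ⟨2, ?_⟩
  rw [hΛ']
  -- differentiability near `T`
  obtain ⟨t₁, ht₁, hdiff⟩ := stub_kernelCalculus ν T u p x₀ t₀ G hS
  -- pinching near `T`
  obtain ⟨t₂, ht₂, c₀, C₁, hc₀, hpinch⟩ := stub_pinching ν T u p x₀ t₀ G hS
  -- slow decrease
  have hsd : SlowlyDecreasingAt (adaptedFrequency u G T) T := stub_slowDecrease ν T u p x₀ t₀ G hS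
  -- a common window `[t₃, T)`, `t₃ ∈ Ioo t₁ T ∩ Ici t₂`
  set t₃ : ℝ := max ((t₁ + T) / 2) t₂ with ht₃
  have ht₃T : t₃ < T := max_lt (by linarith [ht₁.2]) ht₂.2
  have ht₁₃ : t₁ < t₃ := lt_of_lt_of_le (by linarith [ht₁.2]) (le_max_left _ _)
  have ht₂₃ : t₂ ≤ t₃ := le_max_right _ _
  have hd : ∀ t ∈ Ico t₃ T, DifferentiableAt ℝ (adaptedEnstrophy u G) t := fun t ht =>
    (hdiff t ⟨lt_of_lt_of_le ht₁₃ ht.1, ht.2⟩).differentiableAt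
  have hp : ∃ c₀ C₁ : ℝ, 0 < c₀ ∧ ∀ t ∈ Ico t₃ T,
      c₀ ≤ (T - t) ^ 2 * adaptedEnstrophy u G t ∧ (T - t) ^ 2 * adaptedEnstrophy u G t ≤ C₁ :=
    ⟨c₀, C₁, hc₀, fun t ht => hpinch t ⟨le_trans ht₂₃ ht.1, ht.2⟩⟩
  exact stub_landau T t₃ (adaptedEnstrophy u G) ht₃T hd hp hsd

end Summit.NavierStokesRegularity.NavierStokesRegularity.Cruxes.AdaptedFrequencyConverges.Lines.TauberianOmegaLimit

end
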